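import Literature.MathematicalPhysics.QuantumFieldTheory.BalabanImbrieJaffe1984to88.BIJ85BlockAveragesTorus
import Literature.MathematicalPhysics.QuantumFieldTheory.BalabanImbrieJaffe1984to88.BIJ85SmallFieldSplit64
import Literature.MathematicalPhysics.QuantumFieldTheory.BalabanImbrieJaffe1984to88.BIJ88Sect5StatementsPart3
import Literature.MathematicalPhysics.QuantumFieldTheory.BalabanImbrieJaffe1984to88.BIJ88Sect3Translations

/-!
# `BalabanImbrieJaffe1984to88.BIJ88Eq536Linearization` — T. Bałaban, J. Imbrie, A. Jaffe, *Effective action and cluster properties of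
the abelian Higgs model*, Commun. Math. Phys. **114** (1988) 257–315 [BalabanImbrieJaffe1988], **(5.3.6)–(5.3.7)** p. 280 and the two
sentences after **(3.24)** p. 269; T. Bałaban, J. Imbrie, A. Jaffe, *Renormalization of the Higgs model: minimizers, propagators and the
stability of mean field theory*, Commun. Math. Phys. **97** (1985) 299–329 [BalabanImbrieJaffe1985], pp. 303–304 **(2.10)–(2.13)** and
p. 307 **(3.11)–(3.12)**: THE LINEARIZATION OF THE NONLINEAR BLOCK AVERAGE (2.10) INTO THE LINEAR AVERAGE (2.13) for small Lie-algebra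
fields in the axial gauge, and what the gauge-field translation (3.24)/(5.3.1) does to the δ-functions of the renormalization
transformation — ON THE TORUS CARRIER OF RECORD, for the concrete averages (kind «model instance»).

statement-level skeleton of published theorems with citation tags; proofs where landed; nothing here is a claim about the Yang–Mills mass gap

PDF held: `paper:balaban1988-cmp114-bij-abelian-higgs-effective-action` (journal page = PDF page + 256): p. 280 [PDF 24] read as the image
`HOME/lit-balaban-r16/renders/cmp114/original-p024-x2.png`, p. 269 [PDF 13] rendered this session (seat folder `pages/original-p013-x2.png`),
pp. 266, 274 [PDF 10, 18] (r16 renders); `paper:balaban1985-cmp97-bij-higgs-minimizers` (journal page = PDF page + 298): pp. 303–304,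
306–307 [PDF 5–6, 8–9] read as images (`pub-balaban/t4/b2b-balaban-t4-lit2/renders/bij1985/…-p005-x2.png`,
`HOME/lit-balaban-r15/pages/…-p006,p008,p009-x2.png`).

CITATION HEADER (lean-in-tree rule).  Part of the lit-balaban TYPED SKELETON (HOME `run/shared/lean/pub/lit-balaban/`), PHASE-2 proof
seat p31 gen 5 (unit `lit-balaban-p31-g5`; own-lane free-target protocol G.5-34(d); TAKING line HOME/STATUS.md 2026-08-21T06:09:53Z).
WHAT IS REPRODUCED: row `C2.Eq5.3.1-5.3.7` of `HOME/lit-balaban-r16/ROWS-C2-part2.md` (owner r16), members **(5.3.6)–(5.3.7)** (absent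
before this file); row `C2.Eq3.24` of `HOME/lit-balaban-r18/ROWS-C2.md` (owner r18), the two sentences of p. 269 after (3.24); rows
`C1.Eq2.13` and `C1.Eq3.9-3.12` of `HOME/lit-balaban-r15/ROWS-C1.md` (owner r15): (2.13) as the linearization of (2.10), and (3.11)–(3.12)
⇒ the linear constraint *"QA = 0"* of (3.15).

THE PRINTED TEXT (verbatim).  [BalabanImbrieJaffe1985] p. 303: *"define Q on gauge fields on the unit lattice by (Qu)_{yy′} = u(Γ_{yy′})
exp[L^{−d} Σ_{x∈B(y)} ln u(Γ_{yx} ∘ Γ_{xx′} ∘ Γ_{y′x′}^{−1} ∘ Γ_{y′y})]. (2.10) In (2.10) choose the logarithm so that −π ≦ arg ln u < π.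
(2.11) … The average (2.10) is highly nonlinear. We also desire a linear average, defined on Lie algebra variables. Suppose that we can
define A_b = (ie(ε))^{−1} ln u_b. (2.12)"*; p. 304: *"For b′ = (b′₋, b′₊) a (directed) L-lattice bond from b′₋ to b′₊, we define the
average (QA)_{b′} = L^{−(d+1)} Σ_{x∈B(b′₋)} Σ_{b∈Γ_{xx′}} A_b, (2.13) where Γ_{xx′} is the special contour from x to x′ and xx′ is the
parallel transport of the bond b′ to start at x."*; p. 307: *"It then follows that (Qu′)_{b′} = 1 (3.11) for all L-lattice bonds b′. Now
define A′_b by (u′)_b = exp(ie(ε)A′_b). (3.12) … Here C = (∂*∂)^{−1}, restricted to the subspace of A satisfying both QA = 0 and the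
axial gauge condition."*  [BalabanImbrieJaffe1988] p. 269: *"Thus we put u_b = u′_bu_{b′}, if b ∈ B^s(b′) ∩ Λ₁^{(0)*}, u′_b, otherwise,
≡ u′_b(Λ₁^{(0)*}Q^{s*}v)_b, (3.24) … From the restrictions on the fields, we have that u′_b = e^{ie₀A′_b}, with |A′_b| ≦ cp(e₀) in Λ₁^{(0)*}.
The axial gauge δ-functions are invariant under this translation. In Λ₁^{(0)}, δ(v/Qu) becomes proportional to δ(QA′)."*; p. 280:
*"As in (3.24) we put u = u′(Λ₁^{(k)*}Q^{s*}v), (5.3.1) … we obtain that u′_b = e^{ie_kA′_b} with |A′_b| ≦ cp(e_k), for b ∈ Λ₁^{(k)*}. …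
The translation affects the δ-functions as follows. δ_{Ax}(u) = δ_{Ax}(u′), δ(v/Qu) = δ_{Λ₁^{(k)′*c}}(v/Qu) δ_{Λ₁^{(k)′*}}((e_k/2π)QA′),
(5.3.6) where δ_{Λ₁^{(k)′*}}((e_k/2π)QA′) = Π_{b′∈Λ₁^{(k)′*}} δ((e_k/2π)(QA′)(b′)). (5.3.7) The factor e_k/2π arises because
du_b = (e_k/2π)dA_b."*

CARRIERS (all of record; nothing re-declared, R2/R3).  The unit lattice `T₁` = the torus `Balaban1983to89.Site P j` of `Setup` (standing
range `j + 1 ≤ m + K`), the `L`-lattice = `Site P (j+1)`, bonds `PBond`, `U(1) = BIJ88Sect3Statements.U1` read in `ℂ` through `toC`,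
group-valued fields `GaugeField P j U1`.  The nonlinear average **(2.10)–(2.11)** is r18 gen 4's `BIJ85BlockAveragesTorus.qU` (with its
comb contours `Γ_{yx}` = `legBond`/`holC`, straight runs `Γ_{xx′}` = `runBond`/`runC`, loops `loopC`, branch `BIJ85Sect1Model.argB`), the
translation **(3.24)/(5.3.1)** `u = u′·(Q^{s*}w)` is r18's `BIJ85BlockAveragesTorus.surfMul u′ w` (`surfFactor w` = the group-valued
`Q^{s*}w` of [BalabanImbrieJaffe1985] (4.5.2): `w_{b′}` on `B^s(b′)`, `1` elsewhere), the axial trees **(3.4)** are r18 gen 3's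
`BIJ88RenormTransf311.axialBonds`/`DeltaAx`, and the LINEAR average **(2.13)** is r18's `LatticeFieldCalculus.bondAvg` (= B5 (1.11); the
decl the C1 §§4–7 files iterate as `bondAvgIter`).  The cut-off of (5.3.1) is read on the `L`-lattice bonds `Λ` carrying the δ-functions
of (5.3.6)–(5.3.7) (`cutoff Λ v`): for `Λ₁` a union of blocks, a surface bond `b ∈ B^s(b′)` lies in `Λ₁^{(k)*}` iff `b′ ∈ Λ₁^{(k)′*}` — the
fine and the coarse cut-off of the translation agree (`toC_transl_eq_transl531` bridges to r16's fine-cut-off leaf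
`BIJ88Sect5StatementsPart3.transl531`/`uPrime` and to r18's `BIJ88Sect3Translations.u324`/`phase` under exactly this hypothesis).

WHAT IS DEFINED (defs with bodies) / PROVED (0 `sorry`, standard axioms, no `Prop`-valued fact introduced).
* §1 `phaseField θ = (b ↦ e^{iθ_b})` — the field of **(3.12)/(2.12)** with `θ = e(ε)A` — and the ADDITIVE contour functionals matching
  r18's multiplicative ones: `legSum`/`combSum` (`θ(Γ_{yx})`), `runSumL` (`θ(Γ_{xx′})` = `LatticeFieldCalculus.segSum … L`),
  `loopSum` (`θ` of the loop of (2.10)), `combAvg` (`L^{−(d+1)} Σ_{x∈B(y)}[θ(Γ_{yx}) + θ(Γ_{xx′}) − θ(Γ_{y′x′})]`, the full linear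
  average over the contours of (2.10)); PROVED `u(Γ) = exp(iθ(Γ))` for every contour of (2.10) (`holC_phaseField`, `runC_phaseField`,
  `loopC_phaseField`).
* §2 THE BRANCH: if `θ(loop) ∈ [−π, π)` the logarithm (2.11) of the loop variable IS `iθ(loop)` (`argB_loopC_phaseField`), and `|θ_b| ≤ τ`
  with `2(d+1)Lτ < π` puts every loop of (2.10) in that range (`loopSum_mem_Ico`: a loop has fewer than `2(d+1)L` bonds).
* §3 **THE LINEARIZATION**: `qU_phaseField` — for such `θ`, `(Q e^{iθ})_{yy′} = exp(i·L·combAvg θ)` EXACTLY; and in the axial gauge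
  (`θ = 0` on the block trees, which carry every bond of every `Γ_{yx}`: r18's `isAxialBond_legBond`) `combAvg θ = bondAvg θ`
  (`combAvg_eq_bondAvg_of_axial`), whence **`qU_phaseField_axial : (Q e^{iθ})_{b′} = exp(i·L·(Qθ)_{b′})` with `Q` = (2.13)** — the factor
  `L` being the length of the `L`-lattice bond in unit-lattice units (an `L`-lattice bond variable is the transport along `L` unit bonds;
  (2.13) maps constants to constants).  Consequently **`qU_phaseField_eq_one_iff : (Q e^{iθ})_{b′} = 1 ↔ (Qθ)_{b′} = 0`** — (3.11)–(3.12)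
  ⇒ the linear constraint *"QA = 0"* of (3.15); the group axial gauge of `e^{iθ}` is the Lie-algebra axial gauge of `θ`
  (`deltaAx_phaseField_iff`).
* §4 **(5.3.6)–(5.3.7) / p. 269** for the translation `u = u′·(cut-off·Q^{s*}v)` = `surfMul u′ (cutoff Λ v)`: **`deltaAx_surfMul_iff`**
  (*"δ_{Ax}(u) = δ_{Ax}(u′)"*: surface bonds are not tree bonds), **`qU_transl_of_not_mem`** (off the cut-off `(Qu)_c = (Qu′)_c`: the factor
  `δ_{Λ′*c}(v/Qu)` is untouched), **`qU_transl_of_mem`**/**`div_qU_transl_of_mem`** (on it `(Qu)_c = (Qu′)_c·v_c`, i.e. `v/Qu = 1/Qu′` —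
  r18's `qU_surfMul`), and for `u′ = e^{iθ}` small and axial **`qU_transl_eq_iff : (Qu)_c = v_c ↔ (Qθ)_c = 0`** (`c ∈ Λ`) — *"δ(v/Qu) becomes
  proportional to δ(QA′)"* at the level of the constraint sets, bond by bond as in (5.3.7); with the charge made explicit, `θ = e_kA′`,
  `e_k ≠ 0`: **`eq537`** `(Qu)_c = v_c ↔ (QA′)_c = 0`.  The proportionality FACTOR `e_k/2π` of (5.3.7) (*"du_b = (e_k/2π)dA_b"*) is the
  Jacobian of `A_b ↦ u_b` between Lebesgue and normalized Haar measure — a measure-level statement not formalized here (honest scope).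
* §5 Bridges to the typed leaves: `toC_phaseField_eq_uPrime` (r16's `uPrime e_k A′`), `toC_phaseField_eq_phase` (r18's `phase e₀ A′`),
  `toC_transl_eq_transl531` / `toC_transl_eq_u324` (the group-valued translation read in `ℂ` IS r16's (5.3.1) / r18's (3.24) with
  `Q^{s*}v = surfFactor v`, whenever the fine cut-off contains a surface bond iff the coarse cut-off contains its `L`-lattice bond).
Imports: Literature only (r18's `BIJ85BlockAveragesTorus`, gen-1 p30's `BIJ85SmallFieldSplit64` for `argB_exp_mul_I`, r16's Part3 and
r18's `BIJ88Sect3Translations` for the bridges); standard axioms.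
-/

namespace Literature.MathematicalPhysics.QuantumFieldTheory.BalabanImbrieJaffe1984to88.BIJ88Eq536Linearization

open Literature.MathematicalPhysics.QuantumFieldTheory.Balaban1983to89
open BIJ88Sect3Statements (U1 toC toC_mul toC_one)
open BIJ88Sect3Rescaling (toC_injective_U1)
open BIJ85Sect1Model (argB argB_mem_Ico)
open BIJ85SmallFieldSplit64 (argB_exp_mul_I)
open BIJ88RenormTransf311 (inBlock IsAxialBond axialBonds mem_axialBonds DeltaAx)
open BIJ85BlockAveragesTorus
open scoped BigOperators Real
open Complex Finset

noncomputable section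

variable {P : Params} {j : ℕ}

/-! ## §1 The field `e^{iθ}` of (2.12)/(3.12) and the additive contour functionals of (2.10) -/

/-- **(3.12)/(2.12)** *"(u′)_b = exp(ie(ε)A′_b)"*: the `U(1)` field with bond variables `e^{iθ_b}`, `θ = e(ε)A′` the scaled Lie-algebra
field (on the torus carrier of record; `expU1` of r18's file). [cite: BalabanImbrieJaffe1985, (3.12) p.307] -/
def phaseField (θ : PBond P j → ℝ) : GaugeField P j U1 := fun b => expU1 (θ b)

/-- kernel: `u′_b = e^{iθ_b}` read in `ℂ`. [cite: BalabanImbrieJaffe1985, (3.12) p.307] -/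
theorem toC_phaseField (θ : PBond P j → ℝ) (b : PBond P j) : toC (phaseField θ b) = Complex.exp ((θ b : ℂ) * I) :=
  toC_expU1 _

/-- `θ` summed along the leg of `Γ_{yx}` in direction `μ` (the additive form of r18's `legProd`). [cite: BalabanImbrieJaffe1985, (2.5) p.302] -/
def legSum (θ : PBond P j → ℝ) (x : Balaban1983to89.Site P j) (μ : Fin P.d) : ℝ :=
  ∑ t ∈ range (inBlock x μ), θ (legBond x μ t)

/-- `θ(Γ_{yx}) = Σ_{b∈Γ_{yx}} θ_b` along the standard contour from the corner of the block of `x` to `x` (the additive form of r18's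
`holC`). [cite: BalabanImbrieJaffe1985, (2.5) p.302] -/
def combSum (θ : PBond P j → ℝ) (x : Balaban1983to89.Site P j) : ℝ := ∑ μ : Fin P.d, legSum θ x μ

/-- `θ(Γ_{xx′}) = Σ_{b∈Γ_{xx′}} θ_b` along the straight run of `L` unit bonds from `x` (the inner sum of (2.13); the additive form of
r18's `runC`; = `LatticeFieldCalculus.segSum θ x μ L`, `runSumL_eq_segSum`). [cite: BalabanImbrieJaffe1985, (2.13) p.304] -/
def runSumL (θ : PBond P j → ℝ) (x : Balaban1983to89.Site P j) (μ : Fin P.d) : ℝ := ∑ t ∈ range P.L, θ (runBond x μ t)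

/-- `θ` of the closed contour `Γ_{yx} ∘ Γ_{xx′} ∘ Γ_{y′x′}^{−1} ∘ Γ_{y′y}` of (2.10) (reversed contours with a minus sign), for the
`L`-lattice bond `c = ⟨y, y + e_μ⟩` and `x ∈ B(y)`, `x′ = x + Le_μ` (the additive form of r18's `loopC`). [cite: BalabanImbrieJaffe1985, (2.10) p.303] -/
def loopSum (θ : PBond P j → ℝ) (c : PBond P (j+1)) (x : Balaban1983to89.Site P j) : ℝ :=
  combSum θ x + runSumL θ x c.dir - combSum θ (runSite x c.dir P.L) - runSumL θ (corner c.src) c.dir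

/-- The full linear average over the contours of (2.10): `L^{−(d+1)} Σ_{x∈B(y)} [θ(Γ_{yx}) + θ(Γ_{xx′}) − θ(Γ_{y′x′})]` — in the axial
gauge the comb terms drop out and this IS (2.13) (`combAvg_eq_bondAvg_of_axial`). [cite: BalabanImbrieJaffe1985, (2.13) p.304] -/
def combAvg (θ : PBond P j → ℝ) (c : PBond P (j+1)) : ℝ :=
  ((P.L : ℝ) ^ (P.d + 1))⁻¹ * ∑ x ∈ block c.src, (combSum θ x + runSumL θ x c.dir - combSum θ (runSite x c.dir P.L))

/-- kernel: the straight-run sum is r18's `LatticeFieldCalculus.segSum` of (2.13)/B5 (1.8) with `n = L` (same contour, same bonds).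
[cite: BalabanImbrieJaffe1985, (2.13) p.304] -/
theorem runSumL_eq_segSum (θ : PBond P j → ℝ) (x : Balaban1983to89.Site P j) (μ : Fin P.d) :
    runSumL θ x μ = LatticeFieldCalculus.segSum θ x μ P.L := rfl

/-- kernel: `u′(leg) = exp(iθ(leg))`. [cite: BalabanImbrieJaffe1985, (2.5) p.302] -/
theorem legProd_phaseField (θ : PBond P j → ℝ) (x : Balaban1983to89.Site P j) (μ : Fin P.d) :
    legProd (phaseField θ) x μ = Complex.exp ((legSum θ x μ : ℂ) * I) := by
  unfold legProd legSum
  rw [ofReal_sum, sum_mul, Complex.exp_sum]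
  exact prod_congr rfl fun t _ => toC_phaseField θ _

/-- **`u′(Γ_{yx}) = exp(iθ(Γ_{yx}))`** for `u′ = e^{iθ}` (abelian: products of exponentials). [cite: BalabanImbrieJaffe1985, (2.5) p.302] -/
theorem holC_phaseField (θ : PBond P j → ℝ) (x : Balaban1983to89.Site P j) :
    holC (phaseField θ) x = Complex.exp ((combSum θ x : ℂ) * I) := by
  unfold holC combSum
  rw [ofReal_sum, sum_mul, Complex.exp_sum]
  exact prod_congr rfl fun μ _ => legProd_phaseField θ x μ

/-- **`u′(Γ_{xx′}) = exp(iθ(Γ_{xx′}))`**. [cite: BalabanImbrieJaffe1985, (2.10) p.303] -/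
theorem runC_phaseField (θ : PBond P j → ℝ) (x : Balaban1983to89.Site P j) (μ : Fin P.d) :
    runC (phaseField θ) x μ = Complex.exp ((runSumL θ x μ : ℂ) * I) := by
  unfold runC runSumL
  rw [ofReal_sum, sum_mul, Complex.exp_sum]
  exact prod_congr rfl fun t _ => toC_phaseField θ _

/-- **the loop variable of (2.10) is `exp(iθ(loop))`** for `u′ = e^{iθ}`. [cite: BalabanImbrieJaffe1985, (2.10) p.303] -/
theorem loopC_phaseField (θ : PBond P j → ℝ) (c : PBond P (j+1)) (x : Balaban1983to89.Site P j) :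
    loopC (phaseField θ) c x = Complex.exp ((loopSum θ c x : ℂ) * I) := by
  unfold loopC loopSum
  rw [holC_phaseField, runC_phaseField, holC_phaseField, runC_phaseField, ← Complex.exp_neg, ← Complex.exp_neg,
    ← Complex.exp_add, ← Complex.exp_add, ← Complex.exp_add]
  congr 1
  push_cast
  ring

/-! ## §2 The branch (2.11) on small loops -/

/-- kernel: for `θ_b ∈ [−π, π)` the logarithm (2.11) of the bond variable `e^{iθ_b}` is `iθ_b`. [cite: BalabanImbrieJaffe1985, (2.11) p.303] -/
theorem argB_toC_phaseField {θ : PBond P j → ℝ} {b : PBond P j} (h : θ b ∈ Set.Ico (-π) π) :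
    argB (toC (phaseField θ b)) = θ b := by
  rw [toC_phaseField]
  exact argB_exp_mul_I h

/-- kernel: hence the run phase of r18's `qU` is `θ(Γ_{yy′})`. [cite: BalabanImbrieJaffe1985, (2.11) p.303] -/
theorem runArg_phaseField {θ : PBond P j → ℝ} (hθ : ∀ b, θ b ∈ Set.Ico (-π) π) (x : Balaban1983to89.Site P j) (μ : Fin P.d) :
    runArg (phaseField θ) x μ = runSumL θ x μ := by
  unfold runArg runSumL
  exact sum_congr rfl fun t _ => argB_toC_phaseField (hθ _)

/-- **The logarithm (2.11) of a small loop**: if `θ(loop) ∈ [−π, π)` then `(1/i) ln u′(loop) = θ(loop)` — the loops of (2.10) are where the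
branch matters, and for small fields it is the obvious one. [cite: BalabanImbrieJaffe1985, (2.11) p.303] -/
theorem argB_loopC_phaseField {θ : PBond P j → ℝ} {c : PBond P (j+1)} {x : Balaban1983to89.Site P j}
    (h : loopSum θ c x ∈ Set.Ico (-π) π) : argB (loopC (phaseField θ) c x) = loopSum θ c x := by
  rw [loopC_phaseField]
  exact argB_exp_mul_I h

/-- kernel: the exponent of (2.10) for `u′ = e^{iθ}` with small loops is `L^{−d} Σ_{x∈B(y)} θ(loop_x)`. [cite: BalabanImbrieJaffe1985, (2.10) p.303] -/
theorem loopAvg_phaseField {θ : PBond P j → ℝ} {c : PBond P (j+1)} (h : ∀ x ∈ block c.src, loopSum θ c x ∈ Set.Ico (-π) π) :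
    loopAvg (phaseField θ) c = ((P.L : ℝ) ^ P.d)⁻¹ * ∑ x ∈ block c.src, loopSum θ c x := by
  unfold loopAvg
  congr 1
  exact sum_congr rfl fun x hx => argB_loopC_phaseField (h x hx)

/-- kernel: `|θ(leg_μ)| ≤ n_μ·τ ≤ (L−1)τ` for `|θ_b| ≤ τ`. [cite: BalabanImbrieJaffe1985, (2.5) p.302] -/
theorem abs_legSum_le {θ : PBond P j → ℝ} {τ : ℝ} (hθ : ∀ b, |θ b| ≤ τ) (x : Balaban1983to89.Site P j) (μ : Fin P.d) :
    |legSum θ x μ| ≤ (P.L - 1 : ℝ) * τ := by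
  have hlt : inBlock x μ < P.L := Nat.mod_lt _ P.L_pos
  have hτ : 0 ≤ τ := (abs_nonneg _).trans (hθ (legBond x μ 0))
  unfold legSum
  calc |∑ t ∈ range (inBlock x μ), θ (legBond x μ t)| ≤ ∑ t ∈ range (inBlock x μ), |θ (legBond x μ t)| := abs_sum_le_sum_abs _ _
    _ ≤ ∑ _t ∈ range (inBlock x μ), τ := sum_le_sum fun t _ => hθ _
    _ = (inBlock x μ : ℝ) * τ := by rw [sum_const, card_range, nsmul_eq_mul]
    _ ≤ (P.L - 1 : ℝ) * τ := by
        apply mul_le_mul_of_nonneg_right _ hτ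
        have : (inBlock x μ : ℝ) + 1 ≤ P.L := by exact_mod_cast hlt
        linarith

/-- kernel: `|θ(Γ_{yx})| ≤ d(L−1)τ`. [cite: BalabanImbrieJaffe1985, (2.5) p.302] -/
theorem abs_combSum_le {θ : PBond P j → ℝ} {τ : ℝ} (hθ : ∀ b, |θ b| ≤ τ) (x : Balaban1983to89.Site P j) :
    |combSum θ x| ≤ (P.d : ℝ) * ((P.L - 1 : ℝ) * τ) := by
  unfold combSum
  calc |∑ μ : Fin P.d, legSum θ x μ| ≤ ∑ μ : Fin P.d, |legSum θ x μ| := abs_sum_le_sum_abs _ _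
    _ ≤ ∑ _μ : Fin P.d, (P.L - 1 : ℝ) * τ := sum_le_sum fun μ _ => abs_legSum_le hθ x μ
    _ = (P.d : ℝ) * ((P.L - 1 : ℝ) * τ) := by rw [sum_const, card_univ, Fintype.card_fin, nsmul_eq_mul]

/-- kernel: `|θ(Γ_{xx′})| ≤ Lτ`. [cite: BalabanImbrieJaffe1985, (2.13) p.304] -/
theorem abs_runSumL_le {θ : PBond P j → ℝ} {τ : ℝ} (hθ : ∀ b, |θ b| ≤ τ) (x : Balaban1983to89.Site P j) (μ : Fin P.d) :
    |runSumL θ x μ| ≤ (P.L : ℝ) * τ := by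
  unfold runSumL
  calc |∑ t ∈ range P.L, θ (runBond x μ t)| ≤ ∑ t ∈ range P.L, |θ (runBond x μ t)| := abs_sum_le_sum_abs _ _
    _ ≤ ∑ _t ∈ range P.L, τ := sum_le_sum fun t _ => hθ _
    _ = (P.L : ℝ) * τ := by rw [sum_const, card_range, nsmul_eq_mul]

/-- **A loop of (2.10) has fewer than `2(d+1)L` bonds**: `|θ(loop)| ≤ (2L + 2d(L−1))τ < 2(d+1)Lτ` for `|θ_b| ≤ τ`.
[cite: BalabanImbrieJaffe1985, (2.10) p.303] -/
theorem abs_loopSum_le {θ : PBond P j → ℝ} {τ : ℝ} (hθ : ∀ b, |θ b| ≤ τ) (c : PBond P (j+1)) (x : Balaban1983to89.Site P j) :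
    |loopSum θ c x| ≤ 2 * ((P.d : ℝ) + 1) * P.L * τ := by
  have hτ : 0 ≤ τ := (abs_nonneg _).trans (hθ (runBond x c.dir 0))
  have hd : (0 : ℝ) ≤ P.d := Nat.cast_nonneg _
  have h1 := abs_combSum_le hθ x
  have h2 := abs_runSumL_le hθ x c.dir
  have h3 := abs_combSum_le hθ (runSite x c.dir P.L)
  have h4 := abs_runSumL_le hθ (corner c.src) c.dir
  unfold loopSum
  calc |combSum θ x + runSumL θ x c.dir - combSum θ (runSite x c.dir P.L) - runSumL θ (corner c.src) c.dir|
      ≤ |combSum θ x| + |runSumL θ x c.dir| + |combSum θ (runSite x c.dir P.L)| + |runSumL θ (corner c.src) c.dir| := by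
        refine (abs_sub _ _).trans (add_le_add ((abs_sub _ _).trans (add_le_add (abs_add_le _ _) le_rfl)) le_rfl)
    _ ≤ (P.d : ℝ) * ((P.L - 1 : ℝ) * τ) + P.L * τ + (P.d : ℝ) * ((P.L - 1 : ℝ) * τ) + P.L * τ := by linarith
    _ ≤ 2 * ((P.d : ℝ) + 1) * P.L * τ := by nlinarith

/-- **The small-field regime of (5.3.1)/(3.24)** (*"u′_b = e^{ie_kA′_b} with |A′_b| ≦ cp(e_k)"*, `θ = e_kA′`): if `|θ_b| ≤ τ` and
`2(d+1)Lτ < π`, every loop of (2.10) has `θ(loop) ∈ [−π, π)`. [cite: BalabanImbrieJaffe1988, (5.3.1) p.280] -/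
theorem loopSum_mem_Ico {θ : PBond P j → ℝ} {τ : ℝ} (hθ : ∀ b, |θ b| ≤ τ) (hτ : 2 * ((P.d : ℝ) + 1) * P.L * τ < π)
    (c : PBond P (j+1)) (x : Balaban1983to89.Site P j) : loopSum θ c x ∈ Set.Ico (-π) π := by
  have h := (abs_loopSum_le hθ c x).trans_lt hτ
  rw [abs_lt] at h
  exact ⟨h.1.le, h.2⟩

/-- kernel: in the same regime every bond variable is in the range of the branch, `θ_b ∈ [−π, π)` (`τ ≤ 2(d+1)Lτ < π`).
[cite: BalabanImbrieJaffe1988, (5.3.1) p.280] -/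
theorem mem_Ico_of_small {θ : PBond P j → ℝ} {τ : ℝ} (hθ : ∀ b, |θ b| ≤ τ) (hτ : 2 * ((P.d : ℝ) + 1) * P.L * τ < π)
    (b : PBond P j) : θ b ∈ Set.Ico (-π) π := by
  have hτ0 : 0 ≤ τ := (abs_nonneg _).trans (hθ b)
  have hL : (1 : ℝ) ≤ P.L := by exact_mod_cast P.L_pos
  have hd : (0 : ℝ) ≤ P.d := Nat.cast_nonneg _
  have hk : (1 : ℝ) ≤ 2 * ((P.d : ℝ) + 1) * P.L := by nlinarith
  have h1 : τ ≤ 2 * ((P.d : ℝ) + 1) * P.L * τ := by simpa using mul_le_mul_of_nonneg_right hk hτ0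
  have h := (hθ b).trans_lt (h1.trans_lt hτ)
  rw [abs_lt] at h
  exact ⟨h.1.le, h.2⟩

/-! ## §3 The linearization: `Q(e^{iθ}) = exp(i·L·(full average))`, and `= exp(i·L·Qθ)` with `Q` = (2.13) in the axial gauge -/

/-- **(2.10) of `e^{iθ}` is the exponential of a LINEAR functional of `θ`**: for `θ_b ∈ [−π, π)` and all loops of the bond in `[−π, π)`,
`(Q e^{iθ})_{yy′} = exp(i·L·combAvg θ) = exp(i L^{−d} Σ_{x∈B(y)}[θ(Γ_{yx}) + θ(Γ_{xx′}) − θ(Γ_{y′x′})])` — the prefactor `u′(Γ_{yy′})` of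
(2.10) cancels against the `Γ_{y′y}` legs of the loops (standing range). [cite: BalabanImbrieJaffe1985, (2.10) p.303] -/
theorem qU_phaseField (hj : j + 1 ≤ P.m + P.K) {θ : PBond P j → ℝ} (hθ : ∀ b, θ b ∈ Set.Ico (-π) π) {c : PBond P (j+1)}
    (hloop : ∀ x ∈ block c.src, loopSum θ c x ∈ Set.Ico (-π) π) :
    qU (phaseField θ) c = expU1 (P.L * combAvg θ c) := by
  unfold qU
  rw [runArg_phaseField hθ, loopAvg_phaseField hloop]
  congr 1
  unfold loopSum combAvg
  rw [sum_sub_distrib, sum_const, Balaban1983to89.Site.card_block hj, nsmul_eq_mul]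
  have hL : (P.L : ℝ) ≠ 0 := Nat.cast_ne_zero.mpr P.L_pos.ne'
  have hLd : ((P.L : ℝ) ^ P.d) ≠ 0 := pow_ne_zero _ hL
  push_cast
  field_simp
  ring

/-- kernel: in the Lie-algebra axial gauge (`θ = 0` on the block trees of (3.4)) every leg sum vanishes — every bond of `Γ_{yx}` is a tree
bond (r18's `isAxialBond_legBond`). [cite: BalabanImbrieJaffe1985, (3.4) p.306] -/
theorem legSum_eq_zero_of_axial (hj : j + 1 ≤ P.m + P.K) {θ : PBond P j → ℝ} (hax : ∀ b, IsAxialBond b → θ b = 0)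
    (x : Balaban1983to89.Site P j) (μ : Fin P.d) : legSum θ x μ = 0 :=
  sum_eq_zero fun _ ht => hax _ (isAxialBond_legBond hj (mem_range.1 ht))

/-- **In the axial gauge `θ(Γ_{yx}) = 0`** (p. 303: *"In axial gauge we choose h in order to set u_b = 1 for every b which occurs in some
Γ_{yx}"*, Lie-algebra form). [cite: BalabanImbrieJaffe1985, (3.4) p.306] -/
theorem combSum_eq_zero_of_axial (hj : j + 1 ≤ P.m + P.K) {θ : PBond P j → ℝ} (hax : ∀ b, IsAxialBond b → θ b = 0)
    (x : Balaban1983to89.Site P j) : combSum θ x = 0 :=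
  sum_eq_zero fun μ _ => legSum_eq_zero_of_axial hj hax x μ

/-- kernel: a sum over the block `B(y)` is the sum over the offsets `{0,…,L−1}^d` (`Site.blockEquiv`). [folklore] -/
private theorem sum_block_eq_sum_offsets (hj : j + 1 ≤ P.m + P.K) (y : Balaban1983to89.Site P (j+1)) (f : Balaban1983to89.Site P j → ℝ) :
    ∑ x ∈ block y, f x = ∑ r : Fin P.d → Fin P.L, f (Balaban1983to89.Site.blockSite y r) := by
  have hmem : ∀ x : Balaban1983to89.Site P j, blockOf x = y ↔ x ∈ block y := fun x => by simp [block]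
  let e : (Fin P.d → Fin P.L) ≃ ↥(block y) :=
    (Balaban1983to89.Site.blockEquiv hj y).symm.trans (Equiv.subtypeEquivRight hmem)
  rw [← sum_coe_sort (block y) f, ← Equiv.sum_comp e (fun a => f a.1)]
  exact sum_congr rfl fun r _ => rfl

/-- **In the axial gauge the full average over the contours of (2.10) IS (2.13)**: `combAvg θ = Qθ` with `Q` = r18's
`LatticeFieldCalculus.bondAvg` (*"the bonds b which enter the sum (2.13) range over the interior of the two L-blocks … as well as the
(surface) bonds connecting these blocks"*). [cite: BalabanImbrieJaffe1985, (2.13) p.304] -/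
theorem combAvg_eq_bondAvg_of_axial (hj : j + 1 ≤ P.m + P.K) {θ : PBond P j → ℝ} (hax : ∀ b, IsAxialBond b → θ b = 0)
    (c : PBond P (j+1)) : combAvg θ c = LatticeFieldCalculus.bondAvg θ c := by
  unfold combAvg LatticeFieldCalculus.bondAvg
  simp only [combSum_eq_zero_of_axial hj hax, zero_add, sub_zero, smul_eq_mul]
  congr 1
  rw [sum_block_eq_sum_offsets hj]
  exact sum_congr rfl fun r _ => runSumL_eq_segSum θ _ _

/-- **THE LINEARIZATION OF (2.10) INTO (2.13).**  For `u′ = e^{iθ}` in the axial gauge with `|θ_b| ≤ τ`, `2(d+1)Lτ < π`: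
**`(Qu′)_{b′} = exp(i·L·(Qθ)_{b′})`**, `Q` on the left the nonlinear average (2.10) with the branch (2.11) (r18's `qU`), on the right the
linear average (2.13) (r18's `bondAvg`) — p. 303 *"The average (2.10) is highly nonlinear. We also desire a linear average, defined on
Lie algebra variables"* made a theorem; the factor `L` is the length of the `L`-lattice bond `b′ = Γ_{yy′}` in unit bonds (standing range).
[cite: BalabanImbrieJaffe1985, (2.13) p.304] -/
theorem qU_phaseField_axial (hj : j + 1 ≤ P.m + P.K) {θ : PBond P j → ℝ} {τ : ℝ} (hθ : ∀ b, |θ b| ≤ τ)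
    (hτ : 2 * ((P.d : ℝ) + 1) * P.L * τ < π) (hax : ∀ b, IsAxialBond b → θ b = 0) (c : PBond P (j+1)) :
    qU (phaseField θ) c = expU1 (P.L * LatticeFieldCalculus.bondAvg θ c) := by
  rw [qU_phaseField hj (mem_Ico_of_small hθ hτ) (fun x _ => loopSum_mem_Ico hθ hτ c x), combAvg_eq_bondAvg_of_axial hj hax]

/-- kernel: `argB 1 = 0` (the branch (2.11) at the identity). [cite: BalabanImbrieJaffe1985, (2.11) p.303] -/
private theorem argB_one_eq_zero : argB 1 = 0 := by
  have h := argB_exp_mul_I (t := 0) ⟨by linarith [Real.pi_pos], Real.pi_pos⟩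
  simpa using h

/-- kernel: for `t ∈ [−π, π)`, `e^{it} = 1` in `U(1)` iff `t = 0`. [cite: BalabanImbrieJaffe1985, (2.11) p.303] -/
theorem expU1_eq_one_iff {t : ℝ} (ht : t ∈ Set.Ico (-π) π) : expU1 t = 1 ↔ t = 0 := by
  constructor
  · intro h
    have h1 : argB (toC (expU1 t)) = argB (toC 1) := by rw [h]
    rwa [toC_expU1, argB_exp_mul_I ht, toC_one, argB_one_eq_zero] at h1
  · rintro rfl
    apply toC_injective_U1
    rw [toC_expU1, toC_one]
    simp

/-- kernel: `|(Qθ)_c| ≤ τ` for `|θ_b| ≤ τ` ((2.13) is an average of `L^d·L` bond values with total weight `1`).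
[cite: BalabanImbrieJaffe1985, (2.13) p.304] -/
theorem abs_bondAvg_le {θ : PBond P j → ℝ} {τ : ℝ} (hθ : ∀ b, |θ b| ≤ τ) (c : PBond P (j+1)) :
    |LatticeFieldCalculus.bondAvg θ c| ≤ τ := by
  have hL : (0 : ℝ) < P.L := by exact_mod_cast P.L_pos
  have hLd1 : (0 : ℝ) < (P.L : ℝ) ^ (P.d + 1) := pow_pos hL _
  unfold LatticeFieldCalculus.bondAvg
  rw [smul_eq_mul, abs_mul, abs_inv, abs_of_pos hLd1]
  have hsum : |∑ r : Fin P.d → Fin P.L, LatticeFieldCalculus.segSum θ (Balaban1983to89.Site.blockSite c.src r) c.dir P.L|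
      ≤ (P.L : ℝ) ^ (P.d + 1) * τ := by
    calc |∑ r : Fin P.d → Fin P.L, LatticeFieldCalculus.segSum θ (Balaban1983to89.Site.blockSite c.src r) c.dir P.L|
        ≤ ∑ r : Fin P.d → Fin P.L, |LatticeFieldCalculus.segSum θ (Balaban1983to89.Site.blockSite c.src r) c.dir P.L| :=
          abs_sum_le_sum_abs _ _
      _ ≤ ∑ _r : Fin P.d → Fin P.L, (P.L : ℝ) * τ := sum_le_sum fun r _ => by
          rw [← runSumL_eq_segSum]; exact abs_runSumL_le hθ _ _
      _ = (P.L : ℝ) ^ (P.d + 1) * τ := by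
          rw [sum_const, card_univ, Fintype.card_fun, Fintype.card_fin, Fintype.card_fin, nsmul_eq_mul]
          push_cast
          ring
  calc ((P.L : ℝ) ^ (P.d + 1))⁻¹ * |∑ r : Fin P.d → Fin P.L, LatticeFieldCalculus.segSum θ _ c.dir P.L|
      ≤ ((P.L : ℝ) ^ (P.d + 1))⁻¹ * ((P.L : ℝ) ^ (P.d + 1) * τ) :=
        mul_le_mul_of_nonneg_left hsum (inv_nonneg.mpr hLd1.le)
    _ = τ := by field_simp

/-- **(3.11)–(3.12) ⇒ "QA = 0" of (3.15)**: for `u′ = e^{iθ}` small and axial, **`(Qu′)_{b′} = 1 ↔ (Qθ)_{b′} = 0`** — the nonlinear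
constraint of the δ-function `δ(1/Qu′)` is the LINEAR constraint on the Lie-algebra field (p. 307: *"C = (∂*∂)^{−1}, restricted to the
subspace of A satisfying both QA = 0 and the axial gauge condition"*). [cite: BalabanImbrieJaffe1985, (3.12) p.307] -/
theorem qU_phaseField_eq_one_iff (hj : j + 1 ≤ P.m + P.K) {θ : PBond P j → ℝ} {τ : ℝ} (hθ : ∀ b, |θ b| ≤ τ)
    (hτ : 2 * ((P.d : ℝ) + 1) * P.L * τ < π) (hax : ∀ b, IsAxialBond b → θ b = 0) (c : PBond P (j+1)) :
    qU (phaseField θ) c = 1 ↔ LatticeFieldCalculus.bondAvg θ c = 0 := by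
  have hτ0 : 0 ≤ τ := (abs_nonneg _).trans (hθ (runBond (corner c.src) c.dir 0))
  have hL : (0 : ℝ) < P.L := by exact_mod_cast P.L_pos
  have hd : (0 : ℝ) ≤ P.d := Nat.cast_nonneg _
  have hQ := abs_bondAvg_le hθ c
  have hmem : (P.L : ℝ) * LatticeFieldCalculus.bondAvg θ c ∈ Set.Ico (-π) π := by
    have h1 : |(P.L : ℝ) * LatticeFieldCalculus.bondAvg θ c| ≤ P.L * τ := by
      rw [abs_mul, abs_of_pos hL]; exact mul_le_mul_of_nonneg_left hQ hL.le
    have hk : (P.L : ℝ) ≤ 2 * ((P.d : ℝ) + 1) * P.L := by nlinarith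
    have h2 : (P.L : ℝ) * τ ≤ 2 * ((P.d : ℝ) + 1) * P.L * τ := mul_le_mul_of_nonneg_right hk hτ0
    have h := h1.trans_lt (h2.trans_lt hτ)
    rw [abs_lt] at h
    exact ⟨h.1.le, h.2⟩
  rw [qU_phaseField_axial hj hθ hτ hax, expU1_eq_one_iff hmem]
  constructor
  · intro h
    rcases mul_eq_zero.mp h with h | h
    · exact absurd h hL.ne'
    · exact h
  · intro h
    rw [h, mul_zero]

/-- **The group axial gauge of `e^{iθ}` is the Lie-algebra axial gauge of `θ`**: for `θ_b ∈ [−π, π)`, r18's (3.4) `δ_{Ax}` (`u_b = 1` on the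
tree bonds) holds for `u′ = e^{iθ}` iff `θ = 0` on the tree bonds. [cite: BalabanImbrieJaffe1985, (3.4) p.306] -/
theorem deltaAx_phaseField_iff {θ : PBond P j → ℝ} (hθ : ∀ b, θ b ∈ Set.Ico (-π) π) :
    DeltaAx (phaseField θ) ↔ ∀ b, IsAxialBond b → θ b = 0 := by
  unfold DeltaAx
  constructor
  · intro h b hb
    exact (expU1_eq_one_iff (hθ b)).mp (h b (mem_axialBonds.2 hb))
  · intro h b hb
    exact (expU1_eq_one_iff (hθ b)).mpr (h b (mem_axialBonds.1 hb))

/-! ## §4 The translation (3.24)/(5.3.1) and its effect on the δ-functions: (5.3.6)–(5.3.7) -/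

/-- The cut-off block field of (5.3.1)/(3.24): `v` on the `L`-lattice bonds of `Λ` (the bonds `Λ₁^{(k)′*}` carrying the δ-functions of
(5.3.6)–(5.3.7)), `1` elsewhere; the translation is then `u = u′·(Q^{s*}(cut-off·v))` = r18's `surfMul u′ (cutoff Λ v)`.
[cite: BalabanImbrieJaffe1988, (5.3.1) p.280] -/
def cutoff (Λ : Finset (PBond P (j+1))) (v : GaugeField P (j+1) U1) : GaugeField P (j+1) U1 :=
  fun c => if c ∈ Λ then v c else 1

/-- kernel: the cut-off field on `Λ`. [cite: BalabanImbrieJaffe1988, (5.3.1) p.280] -/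
theorem cutoff_of_mem {Λ : Finset (PBond P (j+1))} (v : GaugeField P (j+1) U1) {c : PBond P (j+1)} (hc : c ∈ Λ) :
    cutoff Λ v c = v c := by
  simp [cutoff, hc]

/-- kernel: the cut-off field off `Λ`. [cite: BalabanImbrieJaffe1988, (5.3.1) p.280] -/
theorem cutoff_of_not_mem {Λ : Finset (PBond P (j+1))} (v : GaugeField P (j+1) U1) {c : PBond P (j+1)} (hc : c ∉ Λ) :
    cutoff Λ v c = 1 := by
  simp [cutoff, hc]

/-- kernel: a tree bond of (3.4) is not a surface bond (it stays inside its block: `n_μ + 1 < L`). [cite: BalabanImbrieJaffe1985, (3.4) p.306] -/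
theorem not_isCross_of_isAxialBond {b : PBond P j} (hb : IsAxialBond b) : ¬ IsCross b := by
  intro hc
  have h := hb.2
  unfold IsCross at hc
  omega

/-- kernel: the translation does not touch the tree bonds, `(u′·Q^{s*}w)_b = u′_b` for `b ∈ T(y)`. [cite: BalabanImbrieJaffe1988, (5.3.6) p.280] -/
theorem surfMul_of_isAxialBond (u' : GaugeField P j U1) (w : GaugeField P (j+1) U1) {b : PBond P j} (hb : IsAxialBond b) :
    surfMul u' w b = u' b :=
  surfMul_of_not_isCross u' w (not_isCross_of_isAxialBond hb)

/-- **(5.3.6), first identity: `δ_{Ax}(u) = δ_{Ax}(u′)`** (p. 269: *"The axial gauge δ-functions are invariant under this translation"*) —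
the translated field satisfies the axial gauge conditions (3.4) iff `u′` does, for EVERY surface field `w` (surface bonds are not tree
bonds). [cite: BalabanImbrieJaffe1988, (5.3.6) p.280] -/
theorem deltaAx_surfMul_iff (u' : GaugeField P j U1) (w : GaugeField P (j+1) U1) : DeltaAx (surfMul u' w) ↔ DeltaAx u' := by
  unfold DeltaAx
  constructor
  · intro h b hb
    rw [← surfMul_of_isAxialBond u' w (mem_axialBonds.1 hb)]
    exact h b hb
  · intro h b hb
    rw [surfMul_of_isAxialBond u' w (mem_axialBonds.1 hb)]
    exact h b hb

/-- kernel: **`Q(u′·Q^{s*}(cut-off·v))_c = (Qu′)_c · (cut-off·v)_c`** (r18's `qU_surfMul`, exact for every branch). [cite: BalabanImbrieJaffe1988, (5.3.6) p.280] -/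
theorem qU_transl (hj : j + 1 ≤ P.m + P.K) (Λ : Finset (PBond P (j+1))) (u' : GaugeField P j U1) (v : GaugeField P (j+1) U1)
    (c : PBond P (j+1)) : qU (surfMul u' (cutoff Λ v)) c = qU u' c * cutoff Λ v c := by
  rw [qU_surfMul hj]

/-- **(5.3.6), the factor `δ_{Λ₁^{(k)′*c}}(v/Qu)`**: OFF the cut-off the translation does not change the block average, `(Qu)_c = (Qu′)_c`
(`c ∉ Λ`), so the δ-function there is the untranslated one. [cite: BalabanImbrieJaffe1988, (5.3.6) p.280] -/
theorem qU_transl_of_not_mem (hj : j + 1 ≤ P.m + P.K) {Λ : Finset (PBond P (j+1))} (u' : GaugeField P j U1)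
    (v : GaugeField P (j+1) U1) {c : PBond P (j+1)} (hc : c ∉ Λ) : qU (surfMul u' (cutoff Λ v)) c = qU u' c := by
  rw [qU_transl hj, cutoff_of_not_mem v hc, mul_one]

/-- **(5.3.6), ON the cut-off: `(Qu)_c = (Qu′)_c·v_c`** (`c ∈ Λ`) — *"it removes the v-field from the δ-functions there"*.
[cite: BalabanImbrieJaffe1988, (5.3.6) p.280] -/
theorem qU_transl_of_mem (hj : j + 1 ≤ P.m + P.K) {Λ : Finset (PBond P (j+1))} (u' : GaugeField P j U1)
    (v : GaugeField P (j+1) U1) {c : PBond P (j+1)} (hc : c ∈ Λ) : qU (surfMul u' (cutoff Λ v)) c = qU u' c * v c := by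
  rw [qU_transl hj, cutoff_of_mem v hc]

/-- **(5.3.6), ON the cut-off: `v/Qu = 1/Qu′`** — the argument of the δ-function `δ(v/Qu)` after the translation no longer contains `v`
(`c ∈ Λ`; no commutativity used: `v(qv)^{−1} = q^{−1}`). [cite: BalabanImbrieJaffe1988, (5.3.6) p.280] -/
theorem div_qU_transl_of_mem (hj : j + 1 ≤ P.m + P.K) {Λ : Finset (PBond P (j+1))} (u' : GaugeField P j U1)
    (v : GaugeField P (j+1) U1) {c : PBond P (j+1)} (hc : c ∈ Λ) :
    v c * (qU (surfMul u' (cutoff Λ v)) c)⁻¹ = (qU u' c)⁻¹ := by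
  rw [qU_transl_of_mem hj u' v hc, mul_inv_rev, ← mul_assoc, mul_inv_cancel, one_mul]

/-- **(5.3.6), ON the cut-off, as constraint sets: `(Qu)_c = v_c ↔ (Qu′)_c = 1`** (`c ∈ Λ`). [cite: BalabanImbrieJaffe1988, (5.3.6) p.280] -/
theorem qU_transl_eq_iff_qU_eq_one (hj : j + 1 ≤ P.m + P.K) {Λ : Finset (PBond P (j+1))} (u' : GaugeField P j U1)
    (v : GaugeField P (j+1) U1) {c : PBond P (j+1)} (hc : c ∈ Λ) :
    qU (surfMul u' (cutoff Λ v)) c = v c ↔ qU u' c = 1 := by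
  rw [qU_transl_of_mem hj u' v hc]
  constructor
  · intro h
    have h' : qU u' c * v c * (v c)⁻¹ = v c * (v c)⁻¹ := by rw [h]
    rwa [mul_assoc, mul_inv_cancel, mul_one] at h'
  · intro h
    rw [h, one_mul]

/-- **(5.3.6)–(5.3.7) p. 280 / p. 269** *"In Λ₁, δ(v/Qu) becomes proportional to δ(QA′)"*: for `u′ = e^{iθ}` (`θ = e_kA′`) with
`|θ_b| ≤ τ`, `2(d+1)Lτ < π`, in the axial gauge, and the translation `u = u′·(cut-off·Q^{s*}v)`, on every bond `c` of the cut-off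
**`(Qu)_c = v_c ↔ (Qθ)_c = 0`** with `Q` the LINEAR average (2.13) — the constraint set of `δ(v_c/(Qu)_c)` is that of `δ((Qθ)(c))`, bond by
bond as in the product (5.3.7) (the proportionality factor `e_k/2π` = the Jacobian `du_b = (e_k/2π)dA_b` is measure-level and not
formalized here). [cite: BalabanImbrieJaffe1988, (5.3.7) p.280] -/
theorem qU_transl_eq_iff (hj : j + 1 ≤ P.m + P.K) {θ : PBond P j → ℝ} {τ : ℝ} (hθ : ∀ b, |θ b| ≤ τ)
    (hτ : 2 * ((P.d : ℝ) + 1) * P.L * τ < π) (hax : ∀ b, IsAxialBond b → θ b = 0) {Λ : Finset (PBond P (j+1))}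
    (v : GaugeField P (j+1) U1) {c : PBond P (j+1)} (hc : c ∈ Λ) :
    qU (surfMul (phaseField θ) (cutoff Λ v)) c = v c ↔ LatticeFieldCalculus.bondAvg θ c = 0 := by
  rw [qU_transl_eq_iff_qU_eq_one hj _ v hc, qU_phaseField_eq_one_iff hj hθ hτ hax]

/-- **(5.3.6) ON the cut-off, the value**: `(Qu)_c = exp(i·L·(Qθ)_c)·v_c` for the small axial `u′ = e^{iθ}` (`c ∈ Λ`).
[cite: BalabanImbrieJaffe1988, (5.3.6) p.280] -/
theorem qU_transl_phaseField_of_mem (hj : j + 1 ≤ P.m + P.K) {θ : PBond P j → ℝ} {τ : ℝ} (hθ : ∀ b, |θ b| ≤ τ)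
    (hτ : 2 * ((P.d : ℝ) + 1) * P.L * τ < π) (hax : ∀ b, IsAxialBond b → θ b = 0) {Λ : Finset (PBond P (j+1))}
    (v : GaugeField P (j+1) U1) {c : PBond P (j+1)} (hc : c ∈ Λ) :
    qU (surfMul (phaseField θ) (cutoff Λ v)) c = expU1 (P.L * LatticeFieldCalculus.bondAvg θ c) * v c := by
  rw [qU_transl_of_mem hj _ v hc, qU_phaseField_axial hj hθ hτ hax]

/-- kernel: (2.13) is homogeneous, `Q(eA) = e·QA`. [cite: BalabanImbrieJaffe1985, (2.13) p.304] -/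
theorem bondAvg_const_mul (e : ℝ) (A : PBond P j → ℝ) (c : PBond P (j+1)) :
    LatticeFieldCalculus.bondAvg (fun b => e * A b) c = e * LatticeFieldCalculus.bondAvg A c := by
  unfold LatticeFieldCalculus.bondAvg LatticeFieldCalculus.segSum
  simp only [smul_eq_mul, ← mul_sum]
  ring

/-- **(5.3.6)–(5.3.7) with the charge explicit** (all three printed clauses): for `u′_b = e^{ie_kA′_b}`, `e_k ≠ 0`, `|e_kA′_b| ≤ τ`,
`2(d+1)Lτ < π`, `A′` axial, and the translation (5.3.1) `u = u′·(Λ₁*Q^{s*}v)`: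
(i) `δ_{Ax}(u) = δ_{Ax}(u′)`; (ii) off `Λ₁′*`: `(Qu)_c = (Qu′)_c`; (iii) on `Λ₁′*`: `(Qu)_c = v_c ↔ (QA′)(c) = 0` — the constraint set of
`Π_{b′∈Λ₁′*} δ((e_k/2π)(QA′)(b′))`. [cite: BalabanImbrieJaffe1988, (5.3.7) p.280] -/
theorem eq536_537 (hj : j + 1 ≤ P.m + P.K) {ek : ℝ} (hek : ek ≠ 0) {A' : PBond P j → ℝ} {τ : ℝ} (hA : ∀ b, |ek * A' b| ≤ τ)
    (hτ : 2 * ((P.d : ℝ) + 1) * P.L * τ < π) (hax : ∀ b, IsAxialBond b → A' b = 0) (Λ : Finset (PBond P (j+1)))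
    (v : GaugeField P (j+1) U1) (c : PBond P (j+1)) :
    (DeltaAx (surfMul (phaseField fun b => ek * A' b) (cutoff Λ v)) ↔ DeltaAx (phaseField fun b => ek * A' b)) ∧
    (c ∉ Λ → qU (surfMul (phaseField fun b => ek * A' b) (cutoff Λ v)) c = qU (phaseField fun b => ek * A' b) c) ∧
    (c ∈ Λ → (qU (surfMul (phaseField fun b => ek * A' b) (cutoff Λ v)) c = v c ↔ LatticeFieldCalculus.bondAvg A' c = 0)) := by
  have hax' : ∀ b, IsAxialBond b → ek * A' b = 0 := fun b hb => by rw [hax b hb, mul_zero]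
  refine ⟨deltaAx_surfMul_iff _ _, fun hc => qU_transl_of_not_mem hj _ v hc, fun hc => ?_⟩
  rw [qU_transl_eq_iff hj hA hτ hax' v hc, bondAvg_const_mul]
  exact mul_eq_zero.trans ⟨fun h => h.resolve_left hek, Or.inr⟩

/-! ## §5 Bridges to the typed leaves (r16's (5.3.1) `transl531`/`uPrime`, r18's (3.24) `u324`/`phase`) -/

/-- kernel: `e^{iθ}` with `θ = e_kA′` read in `ℂ` IS r16's `uPrime e_k A′` of (5.3.1). [cite: BalabanImbrieJaffe1988, (5.3.1) p.280] -/
theorem toC_phaseField_eq_uPrime (ek : ℝ) (A' : PBond P j → ℝ) (b : PBond P j) :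
    toC (phaseField (fun b => ek * A' b) b) = BIJ88Sect5StatementsPart3.uPrime ek A' b := by
  rw [toC_phaseField, BIJ88Sect5StatementsPart3.uPrime, mul_comm]

/-- kernel: `e^{iθ}` with `θ = e₀A′` read in `ℂ` IS r18's `phase e₀ A′` of (3.24). [cite: BalabanImbrieJaffe1988, (3.24) p.269] -/
theorem toC_phaseField_eq_phase (e₀ : ℝ) (A' : PBond P j → ℝ) (b : PBond P j) :
    toC (phaseField (fun b => e₀ * A' b) b) = BIJ88Sect3Translations.phase e₀ A' b := by
  rw [toC_phaseField, BIJ88Sect3Translations.phase, mul_comm]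

/-- **The group-valued translation read in `ℂ` IS r16's (5.3.1) `transl531`** with `Q^{s*}v = surfFactor v` (the group-valued surface field
of [BalabanImbrieJaffe1985] (4.5.2)), whenever the fine cut-off `Λ1s` contains a surface bond iff the coarse cut-off `Λ` contains its
`L`-lattice bond (the case of (5.3.1): `Λ₁` a union of blocks). [cite: BalabanImbrieJaffe1988, (5.3.1) p.280] -/
theorem toC_transl_eq_transl531 {Λ1s : Finset (PBond P j)} {Λ : Finset (PBond P (j+1))}
    (hΛ : ∀ b : PBond P j, IsCross b → (b ∈ Λ1s ↔ coarse b ∈ Λ)) (u' : GaugeField P j U1) (v : GaugeField P (j+1) U1)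
    (b : PBond P j) :
    toC (surfMul u' (cutoff Λ v) b) =
      BIJ88Sect5StatementsPart3.transl531 Λ1s (fun b => toC (u' b)) (fun b => toC (surfFactor v b)) b := by
  unfold BIJ88Sect5StatementsPart3.transl531 surfMul surfFactor cutoff
  by_cases hb : IsCross b
  · by_cases hm : b ∈ Λ1s
    · have hc : coarse b ∈ Λ := (hΛ b hb).1 hm
      simp [hb, hm, hc, toC_mul]
    · have hc : coarse b ∉ Λ := fun h => hm ((hΛ b hb).2 h)
      simp [hb, hm, hc]
  · by_cases hm : b ∈ Λ1s
    · simp [hb, hm, toC_one]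
    · simp [hb, hm]

/-- **… and IS r18's (3.24) `u324`** under the same reading (`w = Q^{s*}v = surfFactor v` as data). [cite: BalabanImbrieJaffe1988, (3.24) p.269] -/
theorem toC_transl_eq_u324 {Λ1s : Finset (PBond P j)} {Λ : Finset (PBond P (j+1))}
    (hΛ : ∀ b : PBond P j, IsCross b → (b ∈ Λ1s ↔ coarse b ∈ Λ)) (u' : GaugeField P j U1) (v : GaugeField P (j+1) U1)
    (b : PBond P j) :
    toC (surfMul u' (cutoff Λ v) b) =
      BIJ88Sect3Translations.u324 Λ1s (fun b => toC (u' b)) (fun b => toC (surfFactor v b)) b := by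
  rw [toC_transl_eq_transl531 hΛ]
  rfl

end

end Literature.MathematicalPhysics.QuantumFieldTheory.BalabanImbrieJaffe1984to88.BIJ88Eq536Linearization
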